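import Summits.CriticalPhenomena.PercolationContinuityZ3.Theorems.PercNearOneGluingNoHeavyQuantFarSunSupportWindow
import HarnessLib

/-!
# FAR beyond trees: the SUPPORT LEMMA for reached-set-level certificates — level 0 and the three induction steps

builds on p205010 (kernel theorem, internal audit signed; external expert review pending)

Support file (`--supports stmt-CriticalPhenomena-4575`), seat `prim-cert-1` (gen 30); memo `prim-cert-1/FROM-prim-cert-1-g30-SUPPORT-LEMMA.md`.
Setting of `TK.sunFAR_of_layerCert`; bookkeeping in `…QuantFarSunSupportWindow`; the theorem itself (`TK.support_lemma`) is assembled in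
`…QuantFarSunSupportLemma`.  Fix a window `ω` (more than `j` elements, `ω ⊆ range K`), `Q = range K ∖ ω` (`j` elements) realised as the coverage set
`cov K s (s+L)`, a certificate `(a, b) ≥ 0` satisfying the core inequality, and the level `n(Y) = |Q ∖ Y|` of a set `Y` not splitting `ω`.
* `TK.support_level0` — `b(range K) = b(Q) = 0`, `a_k(range K) = a_k(Q) = 0` for `k ∈ Q` (orbits with `T = ∅`);
* `TK.support_stepI` — at level `n ≥ 1`, `b(X) = 0` for `X ⊇ ω` (all coverages full, `Z = X`, `T = Q ∖ X`);
* `TK.support_stepII` — `b(S) = 0` and `a_k(ω ∪ S) = 0` (`k ∈ Q`) for `S ⊆ Q` (coverages `(range K, Q)`, `Z = ω ∪ S`, `T = Q ∖ S`);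
* `TK.support_stepIII` — `a_k(S) = 0` (`k ∈ Q`) for `S ⊆ Q` (same coverages, `Z = S`).
Each step reads one instance of the core inequality in which, by the induction hypothesis (`IH`, all lower levels), every term other than the target
has sign `≤ 0`.  Elementary [this work]; no sorries, standard axioms.
-/

namespace Summit.CriticalPhenomena.PercolationContinuityZ3.Theorems.HairyCycle

namespace TK

open Finset

variable {K j : ℕ} {a : ℕ → Finset ℕ → ℤ} {b : Finset ℕ → ℤ}

/-! ### Level 0 and the three induction steps -/

section Steps

variable {ω Q : Finset ℕ} {s L : ℕ}
  (ha : ∀ k, ∀ R', R' ⊆ range K → 0 ≤ a k R') (hb : ∀ R', R' ⊆ range K → 0 ≤ b R')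
  (hcore : ∀ l m u v : ℕ, m ≤ l → l ≤ K + 1 → u ≤ v → v ≤ K →
    ∀ Z T : Finset ℕ, Z ⊆ range K → T ⊆ range K → Disjoint Z T →
      0 ≤ (∑ J ∈ T.powerset, Wgen K j a b (cov K l u ∩ (Z ∪ J)) (cov K m v ∩ (Z ∪ (T \ J)))) +
        ∑ J ∈ T.powerset, Wgen K j a b (cov K l v ∩ (Z ∪ J)) (cov K m u ∩ (Z ∪ (T \ J))))
  (hK2j : (0 : ℤ) < (K : ℤ) - 2 * j) (hsL : s + L ≤ K) (hcovQ : cov K s (s + L) = Q)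
  (hωK : ω ⊆ range K) (hQ : ∀ k, k ∈ Q ↔ k < K ∧ k ∉ ω) (hjω : j < ω.card) (hQcard : Q.card = j)

include ha hb hcore hK2j hsL hcovQ hωK hQ hjω hQcard

/-- LEVEL 0: `b(range K) = b(Q) = 0`, `a_k(range K) = a_k(Q) = 0` for `k ∈ Q`. [this work] -/
theorem support_level0 :
    b (range K) = 0 ∧ b Q = 0 ∧ (∀ k ∈ Q, a k (range K) = 0) ∧ (∀ k ∈ Q, a k Q = 0) := by
  have hQK : Q ⊆ range K := fun k hk => mem_range.2 ((hQ k).1 hk).1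
  have hKj : j < (range K).card := lt_of_lt_of_le hjω (card_le_card hωK)
  have orbit0 : ∀ l m u v : ℕ, m ≤ l → l ≤ K + 1 → u ≤ v → v ≤ K → ∀ Z : Finset ℕ, Z ⊆ range K →
      0 ≤ Wgen K j a b (cov K l u ∩ Z) (cov K m v ∩ Z) + Wgen K j a b (cov K l v ∩ Z) (cov K m u ∩ Z) := by
    intro l m u v hml hl huv hv Z hZ
    have h := hcore l m u v hml hl huv hv Z ∅ hZ (empty_subset _) (disjoint_empty_right _)
    simpa only [Finset.powerset_empty, Finset.sum_singleton, union_empty, sdiff_self, Finset.bot_eq_empty] using h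
  -- b(range K) = 0
  have hb_full : b (range K) = 0 := by
    have h := orbit0 (K + 1) (K + 1) 0 0 le_rfl le_rfl le_rfl (Nat.zero_le K) (range K) subset_rfl
    rw [cov_top, inter_self] at h
    have hF : Fgen K j a b (range K) (range K) = -(b (range K) * ((K : ℤ) - 2 * j)) := by
      rw [Fgen_large hKj, sum_full_eq_zero, card_range]; ring
    unfold Wgen at h
    rw [hF] at h
    have h0 := hb (range K) subset_rfl
    nlinarith
  -- b(Q) = 0 and a_k(range K) = 0 on Q
  have h0Q : b Q = 0 ∧ ∀ k ∈ Q, a k (range K) = 0 := by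
    have h := orbit0 (K + 1) s (s + L) (s + L) (by omega) le_rfl le_rfl hsL (range K) subset_rfl
    rw [cov_top, hcovQ, inter_self, inter_eq_left.2 hQK] at h
    have hF1 : Fgen K j a b (range K) Q = -(b Q * ((K : ℤ) - 2 * j)) := by
      rw [Fgen_large hKj, sum_full_eq_zero, card_range]; ring
    have hF2 : Fgen K j a b Q (range K) = -(∑ k ∈ range K, if k ∈ Q then a k (range K) else 0) := by
      rw [Fgen_small hQcard.le, hb_full]; ring
    unfold Wgen at h
    rw [hF1, hF2] at h
    have h1 := hb Q hQK
    have h2 := sum_in_nonneg ha Q (subset_rfl : range K ⊆ range K)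
    have hbQ : b Q = 0 := by nlinarith
    exact ⟨hbQ, zero_of_sum_in ha hQK subset_rfl subset_rfl (by nlinarith)⟩
  -- a_k(Q) = 0 on Q
  have ha_Q : ∀ k ∈ Q, a k Q = 0 := by
    have h := orbit0 (K + 1) (K + 1) 0 0 le_rfl le_rfl le_rfl (Nat.zero_le K) Q hQK
    rw [cov_top, inter_eq_right.2 hQK] at h
    have hF : Fgen K j a b Q Q = -(∑ k ∈ range K, if k ∈ Q then a k Q else 0) - b Q * ((Q.card : ℤ) - 2 * j) :=
      Fgen_small hQcard.le
    unfold Wgen at h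
    rw [hF, h0Q.1] at h
    have h2 := sum_in_nonneg ha Q hQK
    exact zero_of_sum_in ha hQK subset_rfl hQK (by nlinarith)
  exact ⟨hb_full, h0Q.1, h0Q.2, ha_Q⟩

/-- STEP (i): at level `n ≥ 1`, `b(X) = 0` for every `X ⊇ ω` with `|Q ∖ X| = n` (orbit: all coverages full, `Z = X`, `T = Q ∖ X`). [this work] -/
theorem support_stepI {n : ℕ} (hn : 0 < n)
    (IH : ∀ Y' : Finset ℕ, Y' ⊆ range K → (ω ⊆ Y' ∨ Disjoint ω Y') → (Q \ Y').card < n →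
      b Y' = 0 ∧ ∀ k ∈ Q, a k Y' = 0)
    {X : Finset ℕ} (hXK : X ⊆ range K) (hωX : ω ⊆ X) (hXn : (Q \ X).card = n) : b X = 0 := by
  obtain ⟨hb_full, -, ha_full, -⟩ := support_level0 ha hb hcore hK2j hsL hcovQ hωK hQ hjω hQcard
  have hQK : Q ⊆ range K := fun k hk => mem_range.2 ((hQ k).1 hk).1
  set B : Finset ℕ := Q \ X with hB
  have hBK : B ⊆ range K := sdiff_subset.trans hQK
  have hXB : Disjoint X B := disjoint_sdiff
  have hBne : B.Nonempty := by rw [← card_pos, hXn]; exact hn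
  have hXUB : X ∪ B = range K := by
    apply Subset.antisymm (union_subset hXK hBK)
    intro k hk
    rw [mem_union, hB, mem_sdiff]
    by_cases hkX : k ∈ X
    · exact Or.inl hkX
    · exact Or.inr ⟨(hQ k).2 ⟨mem_range.1 hk, fun hkω => hkX (hωX hkω)⟩, hkX⟩
  have h := hcore (K + 1) (K + 1) 0 0 le_rfl le_rfl le_rfl (Nat.zero_le K) X B hXK hBK hXB
  rw [cov_top] at h
  have hzero : ∀ J ∈ B.powerset, J ≠ ∅ ∧ J ≠ B →
      Wgen K j a b (range K ∩ (X ∪ J)) (range K ∩ (X ∪ (B \ J))) = 0 := by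
    intro J hJ hc
    rw [mem_powerset] at hJ
    have hJK : X ∪ J ⊆ range K := union_subset hXK (hJ.trans hBK)
    have hJK' : X ∪ (B \ J) ⊆ range K := union_subset hXK (sdiff_subset.trans hBK)
    rw [inter_eq_right.2 hJK, inter_eq_right.2 hJK']
    have hid1 : Q \ (X ∪ J) = B \ J := by
      ext k; rw [hB]; simp only [mem_sdiff, mem_union]; tauto
    have hid2 : Q \ (X ∪ (B \ J)) = J := by
      ext k; rw [hB]; simp only [mem_sdiff, mem_union]
      constructor
      · intro hk; by_contra hkJ; exact hk.2 (Or.inr ⟨⟨hk.1, fun hkX => hk.2 (Or.inl hkX)⟩, hkJ⟩)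
      · intro hkJ
        have hkB := hJ hkJ; rw [hB, mem_sdiff] at hkB
        exact ⟨hkB.1, fun h' => h'.elim hkB.2 fun h'' => h''.2 hkJ⟩
    have hl1 : (Q \ (X ∪ J)).card < n := by
      rw [hid1, ← hXn]; exact card_lt_card (sdiff_ssubset hJ (nonempty_iff_ne_empty.2 hc.1))
    have hl2 : (Q \ (X ∪ (B \ J))).card < n := by
      rw [hid2, ← hXn]; exact card_lt_card (ssubset_of_subset_of_ne hJ hc.2)
    have ih1 := IH (X ∪ J) hJK (Or.inl (hωX.trans subset_union_left)) hl1
    have ih2 := IH (X ∪ (B \ J)) hJK' (Or.inl (hωX.trans subset_union_left)) hl2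
    exact W_zero_ll hQ hjω (hωX.trans subset_union_left) (hωX.trans subset_union_left) ih1.1 ih2.1 ih1.2 ih2.2
  have hne : (∅ : Finset ℕ) ≠ B := fun h' => hBne.ne_empty h'.symm
  rw [Finset.sum_eq_add_of_mem ∅ B (empty_mem_powerset _) (mem_powerset_self _) hne hzero] at h
  rw [union_empty, sdiff_empty, hXUB, Finset.sdiff_self, union_empty, inter_self, inter_eq_right.2 hXK,
    Wgen_comm K j a b X (range K), W_full_large hQ hjω hωK hωX hb_full ha_full] at h
  have h0 := hb X hXK
  nlinarith

/-- STEP (ii): at level `n ≥ 1`, for `S ⊆ Q` with `|Q ∖ S| = n`: `b(S) = 0` and `a_k(ω ∪ S) = 0` for `k ∈ Q`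
(orbit: coverages `(range K, Q)`, `Z = ω ∪ S`, `T = Q ∖ S`; uses step (i) for `ω ∪ S`). [this work] -/
theorem support_stepII {n : ℕ} (hn : 0 < n)
    (IH : ∀ Y' : Finset ℕ, Y' ⊆ range K → (ω ⊆ Y' ∨ Disjoint ω Y') → (Q \ Y').card < n →
      b Y' = 0 ∧ ∀ k ∈ Q, a k Y' = 0)
    {S : Finset ℕ} (hSQ : S ⊆ Q) (hSn : (Q \ S).card = n) : b S = 0 ∧ ∀ k ∈ Q, a k (ω ∪ S) = 0 := by
  obtain ⟨hb_full, hb_Q, ha_full, ha_Q⟩ := support_level0 ha hb hcore hK2j hsL hcovQ hωK hQ hjω hQcard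
  have hQK : Q ⊆ range K := fun k hk => mem_range.2 ((hQ k).1 hk).1
  have hωQ : Disjoint ω Q := disjoint_left.2 fun k hkω hkQ => ((hQ k).1 hkQ).2 hkω
  have hjK : j < K := by have := lt_of_lt_of_le hjω (card_le_card hωK); rwa [card_range] at this
  set X : Finset ℕ := ω ∪ S with hX
  set B : Finset ℕ := Q \ S with hB
  have hSK : S ⊆ range K := hSQ.trans hQK
  have hXK : X ⊆ range K := union_subset hωK hSK
  have hωX : ω ⊆ X := subset_union_left
  have hBK : B ⊆ range K := sdiff_subset.trans hQK
  have hBQ : B ⊆ Q := sdiff_subset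
  have hBne : B.Nonempty := by rw [← card_pos, hSn]; exact hn
  have hQX : ∀ A : Finset ℕ, A ⊆ Q → Q ∩ (X ∪ A) = S ∪ A := by
    intro A hA; ext k
    simp only [mem_inter, mem_union, hX]
    constructor
    · rintro ⟨hkQ, (hkω | hkS) | hkA⟩
      · exact (((hQ k).1 hkQ).2 hkω).elim
      · exact Or.inl hkS
      · exact Or.inr hkA
    · rintro (hkS | hkA)
      · exact ⟨hSQ hkS, Or.inl (Or.inr hkS)⟩
      · exact ⟨hA hkA, Or.inr hkA⟩
  have hid1 : ∀ J, J ⊆ B → Q \ (X ∪ J) = B \ J := by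
    intro J hJ; ext k; rw [hB]; simp only [mem_sdiff, mem_union, hX]
    constructor
    · rintro ⟨hkQ, hk⟩; exact ⟨⟨hkQ, fun hkS => hk (Or.inl (Or.inr hkS))⟩, fun hkJ => hk (Or.inr hkJ)⟩
    · rintro ⟨⟨hkQ, hkS⟩, hkJ⟩
      exact ⟨hkQ, fun hk => hk.elim (fun hk' => hk'.elim (fun hkω => ((hQ k).1 hkQ).2 hkω) hkS) hkJ⟩
  have hid2 : ∀ J, J ⊆ B → Q \ (S ∪ (B \ J)) = J := by
    intro J hJ; ext k; rw [hB]; simp only [mem_sdiff, mem_union]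
    constructor
    · intro hk; by_contra hkJ; exact hk.2 (Or.inr ⟨⟨hk.1, fun hkS => hk.2 (Or.inl hkS)⟩, hkJ⟩)
    · intro hkJ
      have hkB := hJ hkJ; rw [hB, mem_sdiff] at hkB
      exact ⟨hkB.1, fun h' => h'.elim hkB.2 fun h'' => h''.2 hkJ⟩
  have hQXn : (Q \ X).card = n := by rw [← union_empty X, hid1 ∅ (empty_subset _), sdiff_empty, hSn]
  have hbX : b X = 0 := support_stepI ha hb hcore hK2j hsL hcovQ hωK hQ hjω hQcard hn IH hXK hωX hQXn
  have hXB : Disjoint X B := by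
    rw [hX, disjoint_union_left]
    exact ⟨hωQ.mono_right hBQ, disjoint_sdiff⟩
  have hSUB : S ∪ B = Q := by rw [hB, union_sdiff_of_subset hSQ]
  have hXUB : X ∪ B = range K := by
    rw [hX, union_assoc, hSUB]
    apply Subset.antisymm (union_subset hωK hQK)
    intro k hk
    rw [mem_union]
    by_cases hkω : k ∈ ω
    · exact Or.inl hkω
    · exact Or.inr ((hQ k).2 ⟨mem_range.1 hk, hkω⟩)
  have h := hcore s s 0 (s + L) le_rfl (by omega) (Nat.zero_le _) hsL X B hXK hBK hXB
  rw [cov_zero_right, hcovQ] at h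
  have hzero1 : ∀ J ∈ B.powerset, J ≠ ∅ ∧ J ≠ B →
      Wgen K j a b (range K ∩ (X ∪ J)) (Q ∩ (X ∪ (B \ J))) = 0 := by
    intro J hJ hc
    rw [mem_powerset] at hJ
    have hJK : X ∪ J ⊆ range K := union_subset hXK (hJ.trans hBK)
    rw [inter_eq_right.2 hJK, hQX (B \ J) (sdiff_subset.trans hBQ)]
    have hY'Q : S ∪ (B \ J) ⊆ Q := union_subset hSQ (sdiff_subset.trans hBQ)
    have hl1 : (Q \ (X ∪ J)).card < n := by
      rw [hid1 J hJ, ← hSn]; exact card_lt_card (sdiff_ssubset hJ (nonempty_iff_ne_empty.2 hc.1))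
    have hl2 : (Q \ (S ∪ (B \ J))).card < n := by
      rw [hid2 J hJ, ← hSn]; exact card_lt_card (ssubset_of_subset_of_ne hJ hc.2)
    have ih1 := IH (X ∪ J) hJK (Or.inl (hωX.trans subset_union_left)) hl1
    have ih2 := IH (S ∪ (B \ J)) (hY'Q.trans hQK) (Or.inr (hωQ.mono_right hY'Q)) hl2
    exact W_zero_ls hQ hjω hQcard (hωX.trans subset_union_left) hY'Q ih1.1 ih2.1 ih1.2 ih2.2
  have hzero2 : ∀ J ∈ B.powerset, J ≠ ∅ ∧ J ≠ B →
      Wgen K j a b (Q ∩ (X ∪ J)) (range K ∩ (X ∪ (B \ J))) = 0 := by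
    intro J hJ hc
    rw [mem_powerset] at hJ
    have hJ' : B \ J ⊆ B := sdiff_subset
    have hJK' : X ∪ (B \ J) ⊆ range K := union_subset hXK (hJ'.trans hBK)
    rw [inter_eq_right.2 hJK', hQX J (hJ.trans hBQ), Wgen_comm]
    have hY'Q : S ∪ J ⊆ Q := union_subset hSQ (hJ.trans hBQ)
    have hBJ : B \ (B \ J) = J := by rw [sdiff_sdiff_right_self, inf_eq_inter, inter_eq_right.2 hJ]
    have hl1 : (Q \ (X ∪ (B \ J))).card < n := by
      rw [hid1 (B \ J) hJ', hBJ, ← hSn]; exact card_lt_card (ssubset_of_subset_of_ne hJ hc.2)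
    have hl2 : (Q \ (S ∪ J)).card < n := by
      have : Q \ (S ∪ J) = B \ J := by
        rw [← hid2 (B \ J) hJ', hBJ]
      rw [this, ← hSn]; exact card_lt_card (sdiff_ssubset hJ (nonempty_iff_ne_empty.2 hc.1))
    have ih1 := IH (X ∪ (B \ J)) hJK' (Or.inl (hωX.trans subset_union_left)) hl1
    have ih2 := IH (S ∪ J) (hY'Q.trans hQK) (Or.inr (hωQ.mono_right hY'Q)) hl2
    exact W_zero_ls hQ hjω hQcard (hωX.trans subset_union_left) hY'Q ih1.1 ih2.1 ih1.2 ih2.2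
  have hne : (∅ : Finset ℕ) ≠ B := fun h' => hBne.ne_empty h'.symm
  rw [Finset.sum_eq_add_of_mem ∅ B (empty_mem_powerset _) (mem_powerset_self _) hne hzero1,
    Finset.sum_eq_add_of_mem ∅ B (empty_mem_powerset _) (mem_powerset_self _) hne hzero2] at h
  have hQX0 : Q ∩ X = S := by rw [← union_empty X, hQX ∅ (empty_subset _), union_empty]
  rw [union_empty, sdiff_empty, Finset.sdiff_self, union_empty, hXUB, inter_self, inter_eq_right.2 hXK,
    inter_eq_left.2 hQK, hQX0, Wgen_comm K j a b S (range K), Wgen_comm K j a b Q X,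
    W_large_Q hQ hjω hQcard hωX hb_Q ha_Q, W_full_small hQ hQcard hjK hSQ hb_full ha_full, hbX] at h
  have h1 := hb S hSK
  have h2 := sum_in_nonneg ha Q hXK
  have hbS : b S = 0 := by nlinarith
  exact ⟨hbS, zero_of_sum_in ha hQK subset_rfl hXK (by nlinarith)⟩

/-- STEP (iii): at level `n ≥ 1`, for `S ⊆ Q` with `|Q ∖ S| = n` and `b(S) = 0`: `a_k(S) = 0` for `k ∈ Q`
(orbit: coverages `(range K, Q)`, `Z = S`, `T = Q ∖ S`). [this work] -/
theorem support_stepIII {n : ℕ} (hn : 0 < n)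
    (IH : ∀ Y' : Finset ℕ, Y' ⊆ range K → (ω ⊆ Y' ∨ Disjoint ω Y') → (Q \ Y').card < n →
      b Y' = 0 ∧ ∀ k ∈ Q, a k Y' = 0)
    {S : Finset ℕ} (hSQ : S ⊆ Q) (hSn : (Q \ S).card = n) (hbS : b S = 0) : ∀ k ∈ Q, a k S = 0 := by
  obtain ⟨-, hb_Q, -, ha_Q⟩ := support_level0 ha hb hcore hK2j hsL hcovQ hωK hQ hjω hQcard
  have hQK : Q ⊆ range K := fun k hk => mem_range.2 ((hQ k).1 hk).1
  have hωQ : Disjoint ω Q := disjoint_left.2 fun k hkω hkQ => ((hQ k).1 hkQ).2 hkω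
  set B : Finset ℕ := Q \ S with hB
  have hSK : S ⊆ range K := hSQ.trans hQK
  have hBK : B ⊆ range K := sdiff_subset.trans hQK
  have hBQ : B ⊆ Q := sdiff_subset
  have hBne : B.Nonempty := by rw [← card_pos, hSn]; exact hn
  have hSB : Disjoint S B := disjoint_sdiff
  have hSUB : S ∪ B = Q := by rw [hB, union_sdiff_of_subset hSQ]
  have h := hcore s s 0 (s + L) le_rfl (by omega) (Nat.zero_le _) hsL S B hSK hBK hSB
  rw [cov_zero_right, hcovQ] at h
  have hid1 : ∀ J, J ⊆ B → Q \ (S ∪ J) = B \ J := by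
    intro J hJ; ext k; rw [hB]; simp only [mem_sdiff, mem_union]; tauto
  have hid2 : ∀ J, J ⊆ B → Q \ (S ∪ (B \ J)) = J := by
    intro J hJ; ext k; rw [hB]; simp only [mem_sdiff, mem_union]
    constructor
    · intro hk; by_contra hkJ; exact hk.2 (Or.inr ⟨⟨hk.1, fun hkS => hk.2 (Or.inl hkS)⟩, hkJ⟩)
    · intro hkJ
      have hkB := hJ hkJ; rw [hB, mem_sdiff] at hkB
      exact ⟨hkB.1, fun h' => h'.elim hkB.2 fun h'' => h''.2 hkJ⟩
  have hmid : ∀ J ∈ B.powerset, J ≠ ∅ ∧ J ≠ B → Wgen K j a b (S ∪ J) (S ∪ (B \ J)) = 0 := by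
    intro J hJ hc
    rw [mem_powerset] at hJ
    have h1Q : S ∪ J ⊆ Q := union_subset hSQ (hJ.trans hBQ)
    have h2Q : S ∪ (B \ J) ⊆ Q := union_subset hSQ (sdiff_subset.trans hBQ)
    have hl1 : (Q \ (S ∪ J)).card < n := by
      rw [hid1 J hJ, ← hSn]; exact card_lt_card (sdiff_ssubset hJ (nonempty_iff_ne_empty.2 hc.1))
    have hl2 : (Q \ (S ∪ (B \ J))).card < n := by
      rw [hid2 J hJ, ← hSn]; exact card_lt_card (ssubset_of_subset_of_ne hJ hc.2)
    have ih1 := IH (S ∪ J) (h1Q.trans hQK) (Or.inr (hωQ.mono_right h1Q)) hl1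
    have ih2 := IH (S ∪ (B \ J)) (h2Q.trans hQK) (Or.inr (hωQ.mono_right h2Q)) hl2
    exact W_zero_ss hQcard h1Q h2Q ih1.1 ih2.1 ih1.2 ih2.2
  have hzero1 : ∀ J ∈ B.powerset, J ≠ ∅ ∧ J ≠ B →
      Wgen K j a b (range K ∩ (S ∪ J)) (Q ∩ (S ∪ (B \ J))) = 0 := by
    intro J hJ hc
    have hJ' := mem_powerset.1 hJ
    rw [inter_eq_right.2 ((union_subset hSQ (hJ'.trans hBQ)).trans hQK),
      inter_eq_right.2 (union_subset hSQ (sdiff_subset.trans hBQ))]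
    exact hmid J hJ hc
  have hzero2 : ∀ J ∈ B.powerset, J ≠ ∅ ∧ J ≠ B →
      Wgen K j a b (Q ∩ (S ∪ J)) (range K ∩ (S ∪ (B \ J))) = 0 := by
    intro J hJ hc
    have hJ' := mem_powerset.1 hJ
    rw [inter_eq_right.2 (union_subset hSQ (hJ'.trans hBQ)),
      inter_eq_right.2 ((union_subset hSQ (sdiff_subset.trans hBQ)).trans hQK)]
    exact hmid J hJ hc
  have hne : (∅ : Finset ℕ) ≠ B := fun h' => hBne.ne_empty h'.symm
  rw [Finset.sum_eq_add_of_mem ∅ B (empty_mem_powerset _) (mem_powerset_self _) hne hzero1,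
    Finset.sum_eq_add_of_mem ∅ B (empty_mem_powerset _) (mem_powerset_self _) hne hzero2] at h
  rw [union_empty, sdiff_empty, Finset.sdiff_self, union_empty, hSUB, inter_self, inter_eq_right.2 hSK,
    inter_eq_right.2 hQK, inter_eq_right.2 hSQ,
    Wgen_comm K j a b Q S, W_small_Q hQcard hSQ hb_Q ha_Q, hbS] at h
  have h2 := sum_in_nonneg ha Q hSK
  exact zero_of_sum_in ha hQK subset_rfl hSK (by nlinarith)

end Steps

end TK

end Summit.CriticalPhenomena.PercolationContinuityZ3.Theorems.HairyCycle
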